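import Literature.NumberTheory.EllipticCurves.IwasawaSelmerControlAwayFromPProofs
import Literature.NumberTheory.EllipticCurves.GoodReductionLangLift
import Literature.NumberTheory.EllipticCurves.SingularCubic
import HarnessLib

/-!
# `E₀(K_v^{nr})` is `n`-divisible for `n` prime to `v` (Hensel over `K_v^{nr}`, `Ẽ_ns(k̄)` divisible, `[n]` on `E₁`)

`Proofs` file (THEOREMS ONLY: no definition, no named fact, no instance, no `sorry`) in topic
`NumberTheory/EllipticCurves`, in the local setting of `IwasawaSelmerControlAwayFromPProofs` /
`GoodReductionLangLift`: `K` a number field, `v` a finite place, `K_v = v.adicCompletion K`,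
`K̄_v = AlgebraicClosure K_v` with its spectral valuation `w` (`hw`), `𝓞_v = v.adicCompletionIntegers K`,
`𝒪_w = w.integer` (residue field `k₀ = 𝒪_w/𝔪_w`, an algebraic closure of `k_v`), `𝔐 ∈ v.localPrimesAbove` with
inertia group `I_𝔐 ≤ Γ_{K_v}` (so that `K_v^{nr} = (K̄_v)^{I_𝔐}`), the minimal model
`M = W.localMinimalIntegralModel v` of an elliptic curve `E/K` (`W`), `X = M ⊗ K_v`, `V = X ⊗ K̄_v`, the subgroup
`E₀ = {P | ReducesToNonsingular |·|_v P}` of points with nonsingular reduction (`KodairaNeronUnramified`) and the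
kernel of reduction `E₁ = FormalGroupChart.kernel`.

## Main results

* `WeierstrassCurve.exists_nsmul_eq_of_Δ_eq_zero` — **`Ẽ_ns(k)` is `n`-divisible** for a singular Weierstrass
  cubic over an algebraically closed field `k` and `n` invertible in `k` (node: `Ẽ_ns ≅ kˣ`, cusp: `Ẽ_ns ≅ k⁺`,
  Silverman *AEC* III.2.5, the tree's `nonempty_point_addEquiv_units_of_node` / `…_of_cusp`).
* `IsDedekindDomain.HeightOneSpectrum.exists_equation_residue_eq_forall_inertia` — **inertia-invariant Hensel
  lift of a nonsingular point of the reduction**: for an `𝒪_w`-equation `W₀` whose coefficients are fixed by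
  `I_𝔐` and a nonsingular affine point `(α₀, β₀)` of `W₀ mod 𝔪_w`, there are `a, b ∈ 𝒪_w` FIXED BY `I_𝔐` on
  `W₀` with residues `(α₀, β₀)` (Teichmüller lift of one coordinate, Hensel in the other at a non-vanishing
  partial derivative; the block (R5) of `GoodReductionLangLift.exists_lift_sub_mem_kernel`, which needs only the
  nonsingularity of the reduced point, not good reduction).
* `WeierstrassCurve.exists_nsmul_eq_of_reducesToNonsingular_of_forall_inertia` (**main**) — **`E₀(K_v^{nr})` is
  `n`-divisible at a place of bad reduction, for `n` a unit of `𝓞_v`**: on `V`, every `I_𝔐`-fixed point `P`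
  with nonsingular reduction is `n • Q` for an `I_𝔐`-fixed `Q` with nonsingular reduction. Proof
  (Silverman, *AEC*, VII.2.1–2.2, VII.3.1, III.2.5; Greenberg, LNM 1716, §2, `ℓ ≠ p`): reduce `P` to
  `Ẽ_ns(k₀)`, divide there by `n` (`k₀` algebraically closed, `n ≠ 0` in `k₀`), lift the quotient
  `I_𝔐`-invariantly (`E₀ → Ẽ_ns(k₀)` is a homomorphism with kernel `E₁`, `ReductionHomomorphism`), and correct
  inside `E₁ ∩ V(K_v^{nr})`, which is `n`-divisible in `E₁` (`exists_nsmul_eq_of_mem_kernel_of_forall_inertia`)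
  with `I_𝔐`-fixed quotients since `E₁` has no `n`-torsion (`eq_zero_of_nsmul_eq_zero_of_mem_kernel`).

This is the input "(DIV) `E₀ ∩ E(K̄_v)^{I}` is `p`-divisible" of
`LambdaAdicSelmerDataSaturatedDivisibility` (clause `(S)` of Howard's Selmer criterion for the compact control
map `𝔖_p(K_∞) → H¹(K, T_𝔮)` at the bad places `v ∤ p`).

## References

* J. H. Silverman, *The Arithmetic of Elliptic Curves*, 2nd ed. (2009): Prop. III.2.5, VII.§2 (Props. 2.1, 2.2),
  Prop. VII.3.1, Cor. VII.6.2.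
* R. Greenberg, *Iwasawa theory for elliptic curves*, LNM 1716 (1999), §2 (the case `ℓ ≠ p`).
* J. Neukirch, *Algebraic Number Theory* (1999), II §6 (Hensel), §9 (9.9) (residue field of `K^{nr}`).

## Design

No definitions; `noncomputable section`, `open scoped Classical NNReal`, one universe `u`. Conventions (long
lines, the action of `σ ∈ Γ_{K_v}` on `V(K̄_v)` by `Affine.Point.map` of `σ` as a `K_v`-algebra endomorphism of
`K̄_v`, `I_𝔐`-fixedness as a hypothesis `∀ τ ∈ 𝔐.inertia …`) as in `IwasawaSelmerControlAwayFromPProofs`.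
Axioms: `propext`, `Classical.choice`, `Quot.sound`. No summit statement is proved here.
-/

noncomputable section

open scoped Classical NNReal
open NumberField IsDedekindDomain Field Polynomial

universe u

/-! ## §1 `Ẽ_ns(k)` is divisible by every `n` invertible in the algebraically closed field `k` -/

namespace WeierstrassCurve

/-- **`Ẽ_ns(k)` is `n`-divisible for `n` invertible in `k`** (`k` algebraically closed, `Δ = 0`): every point of
Mathlib's group of nonsingular points of a singular Weierstrass cubic `V/k` is `n • Q`. Node (`c₄ ≠ 0`):
`Ẽ_ns(k) ≅ kˣ` and `n`-th roots exist in `k`; cusp (`c₄ = 0`): `Ẽ_ns(k) ≅ k⁺` and `n` is invertible.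
Silverman, *AEC*, Prop. III.2.5 and Exercise 3.5. [cite: SilvermanAEC2009, Prop. III.2.5] -/
theorem exists_nsmul_eq_of_Δ_eq_zero {k : Type u} [Field k] [IsAlgClosed k] (V : WeierstrassCurve k)
    (hΔ : V.Δ = 0) {n : ℕ} (hn : (n : k) ≠ 0) (P : V.toAffine.Point) :
    ∃ Q : V.toAffine.Point, n • Q = P := by
  have hn0 : n ≠ 0 := by rintro rfl; exact hn Nat.cast_zero
  by_cases hc₄ : V.c₄ = 0
  · -- cusp: `Ẽ_ns ≅ k⁺`
    obtain ⟨e⟩ := V.nonempty_point_addEquiv_of_cusp hΔ hc₄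
    refine ⟨e.symm ((n : k)⁻¹ * e P), e.injective ?_⟩
    rw [map_nsmul, e.apply_symm_apply, nsmul_eq_mul, ← mul_assoc, mul_inv_cancel₀ hn, one_mul]
  · -- node: `Ẽ_ns ≅ kˣ`
    obtain ⟨e⟩ := V.nonempty_point_addEquiv_units_of_node hΔ hc₄
    set u : kˣ := Additive.toMul (e P) with hu
    obtain ⟨z, hz⟩ := IsAlgClosed.exists_pow_nat_eq (u : k) (Nat.pos_of_ne_zero hn0)
    have hz0 : z ≠ 0 := by
      rintro rfl
      rw [zero_pow hn0] at hz
      exact u.ne_zero hz.symm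
    refine ⟨e.symm (Additive.ofMul (Units.mk0 z hz0)), e.injective ?_⟩
    rw [map_nsmul, e.apply_symm_apply, ← ofMul_pow]
    have hzu : Units.mk0 z hz0 ^ n = u := Units.ext (by rw [Units.val_pow_eq_pow_val, Units.val_mk0, hz])
    rw [hzu, hu, ofMul_toMul]

end WeierstrassCurve

/-! ## §2 Inertia-invariant Hensel lifts of nonsingular points of the reduction -/

namespace IsDedekindDomain.HeightOneSpectrum

open Literature.NumberTheory.EllipticCurves Literature.NumberTheory.GaloisRepresentations WeierstrassCurve

variable {K : Type u} [Field K] [NumberField K] {v : HeightOneSpectrum (𝓞 K)}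
  {w : Valuation (AlgebraicClosure (v.adicCompletion K)) ℝ≥0}
  (hw : ∀ x, (w x : ℝ) = spectralNorm (v.adicCompletion K) (AlgebraicClosure (v.adicCompletion K)) x)

include hw in
set_option maxHeartbeats 800000 in
/-- **Inertia-invariant Hensel lift of a nonsingular point of the reduction.** Let `W₀` be a Weierstrass
equation over `𝒪_w` (the valuation ring of `K̄_v` for `|·|_v`) whose coefficients are fixed by the inertia
group `I_𝔐 ≤ Γ_{K_v}`, and `(α₀, β₀)` a NONSINGULAR affine point of the reduced cubic `W₀ mod 𝔪_w` over
`k₀ = 𝒪_w/𝔪_w`. Then there are `a, b ∈ 𝒪_w`, both fixed by `I_𝔐`, with `W₀(a, b) = 0` and residues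
`(ā, b̄) = (α₀, β₀)`: if `∂f/∂y ≠ 0` at `(α₀, β₀)`, lift `α₀` to an `I_𝔐`-invariant `a` (a Teichmüller
representative, `exists_residue_eq_forall_inertia`) and solve the monic quadratic `f(a, Y) = 0` by Hensel at the
simple root `β₀` (`exists_isRoot_residue_eq_forall`: the Hensel lift is unique, hence fixed by every inertial
isometry fixing the coefficients); otherwise `∂f/∂x ≠ 0` and one lifts `β₀` and solves the monic cubic in `X`.
(Silverman, *AEC*, VII.2.1: "by Hensel's lemma … `Ẽ_ns(k)` … lifts"; the block (R5) of
`GoodReductionLangLift.exists_lift_sub_mem_kernel`, which uses only the nonsingularity of the reduced point;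
Literature-side twin of `Summit.BirchSwinnertonDyer.Rank1Residual.GaloisImage.TwistedWitness.exists_inertia_invariant_lift`
(`Summits/…/InertiaInvariantHenselLift.lean`), which a `Literature` file cannot import.)
[cite: SilvermanAEC2009, Prop. VII.2.1 (surjectivity of `E₀(K) → Ẽ_ns(k)` for complete `K`, by Hensel's lemma)]
[cite: NeukirchANT1999, Ch. II §6 (Hensel's lemma) and §9 Prop. (9.9)] -/
theorem exists_equation_residue_eq_forall_inertia {𝔐 : Ideal v.localAbsIntegers} (h𝔐 : 𝔐 ∈ v.localPrimesAbove)
    (W₀ : WeierstrassCurve w.integer)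
    (hW₀ : ∀ τ ∈ 𝔐.inertia (absoluteGaloisGroup (v.adicCompletion K)),
      absoluteGaloisGroup.toAlgEquiv (v.adicCompletion K) τ (W₀.a₁ : AlgebraicClosure (v.adicCompletion K)) = W₀.a₁ ∧
      absoluteGaloisGroup.toAlgEquiv (v.adicCompletion K) τ (W₀.a₂ : AlgebraicClosure (v.adicCompletion K)) = W₀.a₂ ∧
      absoluteGaloisGroup.toAlgEquiv (v.adicCompletion K) τ (W₀.a₃ : AlgebraicClosure (v.adicCompletion K)) = W₀.a₃ ∧
      absoluteGaloisGroup.toAlgEquiv (v.adicCompletion K) τ (W₀.a₄ : AlgebraicClosure (v.adicCompletion K)) = W₀.a₄ ∧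
      absoluteGaloisGroup.toAlgEquiv (v.adicCompletion K) τ (W₀.a₆ : AlgebraicClosure (v.adicCompletion K)) = W₀.a₆)
    {α₀ β₀ : IsLocalRing.ResidueField w.integer}
    (hns : (W₀.map (IsLocalRing.residue w.integer)).toAffine.Nonsingular α₀ β₀) :
    ∃ a b : w.integer, W₀.toAffine.Equation a b ∧ IsLocalRing.residue w.integer a = α₀ ∧
      IsLocalRing.residue w.integer b = β₀ ∧
      ∀ τ ∈ 𝔐.inertia (absoluteGaloisGroup (v.adicCompletion K)),
        absoluteGaloisGroup.toAlgEquiv (v.adicCompletion K) τ (a : AlgebraicClosure (v.adicCompletion K)) = a ∧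
        absoluteGaloisGroup.toAlgEquiv (v.adicCompletion K) τ (b : AlgebraicClosure (v.adicCompletion K)) = b := by
  -- the subring of `𝒪_w` fixed by `I_𝔐`
  let S : Subring w.integer :=
    { carrier := {z | ∀ τ ∈ 𝔐.inertia (absoluteGaloisGroup (v.adicCompletion K)),
        absoluteGaloisGroup.toAlgEquiv (v.adicCompletion K) τ (z : AlgebraicClosure (v.adicCompletion K)) = z}
      one_mem' := fun τ _ ↦ by simp
      zero_mem' := fun τ _ ↦ by simp
      add_mem' := fun {a b} ha hb τ hτ ↦ by
        simp only [Set.mem_setOf_eq] at ha hb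
        rw [Subring.coe_add, map_add, ha τ hτ, hb τ hτ]
      mul_mem' := fun {a b} ha hb τ hτ ↦ by
        simp only [Set.mem_setOf_eq] at ha hb
        rw [Subring.coe_mul, map_mul, ha τ hτ, hb τ hτ]
      neg_mem' := fun {a} ha τ hτ ↦ by
        simp only [Set.mem_setOf_eq] at ha
        rw [Subring.coe_neg, map_neg, ha τ hτ] }
  have ha₁S : W₀.a₁ ∈ S := fun τ hτ ↦ (hW₀ τ hτ).1
  have ha₂S : W₀.a₂ ∈ S := fun τ hτ ↦ (hW₀ τ hτ).2.1
  have ha₃S : W₀.a₃ ∈ S := fun τ hτ ↦ (hW₀ τ hτ).2.2.1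
  have ha₄S : W₀.a₄ ∈ S := fun τ hτ ↦ (hW₀ τ hτ).2.2.2.1
  have ha₆S : W₀.a₆ ∈ S := fun τ hτ ↦ (hW₀ τ hτ).2.2.2.2
  -- it suffices to produce `a, b ∈ S`
  suffices lift : ∃ a b : w.integer, W₀.toAffine.Equation a b ∧ IsLocalRing.residue w.integer a = α₀ ∧
      IsLocalRing.residue w.integer b = β₀ ∧ a ∈ S ∧ b ∈ S by
    obtain ⟨a, b, hab, ha, hb, haS, hbS⟩ := lift
    exact ⟨a, b, hab, ha, hb, fun τ hτ ↦ ⟨haS τ hτ, hbS τ hτ⟩⟩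
  obtain ⟨heq, hpart⟩ := (Affine.nonsingular_iff' _ _).mp hns
  rw [Affine.equation_iff] at heq
  have ea₁ : (W₀.map (IsLocalRing.residue w.integer)).toAffine.a₁ = IsLocalRing.residue w.integer W₀.a₁ := rfl
  have ea₂ : (W₀.map (IsLocalRing.residue w.integer)).toAffine.a₂ = IsLocalRing.residue w.integer W₀.a₂ := rfl
  have ea₃ : (W₀.map (IsLocalRing.residue w.integer)).toAffine.a₃ = IsLocalRing.residue w.integer W₀.a₃ := rfl
  have ea₄ : (W₀.map (IsLocalRing.residue w.integer)).toAffine.a₄ = IsLocalRing.residue w.integer W₀.a₄ := rfl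
  have ea₆ : (W₀.map (IsLocalRing.residue w.integer)).toAffine.a₆ = IsLocalRing.residue w.integer W₀.a₆ := rfl
  rw [ea₁, ea₂, ea₃, ea₄, ea₆] at heq
  rw [ea₁, ea₂, ea₃, ea₄] at hpart
  by_cases hY : 2 * β₀ + IsLocalRing.residue w.integer W₀.a₁ * α₀ + IsLocalRing.residue w.integer W₀.a₃ ≠ 0
  · -- lift `α₀` invariantly, solve the monic quadratic in `Y` by Hensel
    obtain ⟨a, ha, haI⟩ := exists_residue_eq_forall_inertia hw h𝔐 α₀
    have haS : a ∈ S := haI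
    set c₁ : w.integer := W₀.a₁ * a + W₀.a₃ with hc₁
    set c₀ : w.integer := a ^ 3 + W₀.a₂ * a ^ 2 + W₀.a₄ * a + W₀.a₆ with hc₀
    have hc₁S : c₁ ∈ S := S.add_mem (S.mul_mem ha₁S haS) ha₃S
    have hc₀S : c₀ ∈ S := S.add_mem (S.add_mem (S.add_mem (S.pow_mem haS 3)
      (S.mul_mem ha₂S (S.pow_mem haS 2))) (S.mul_mem ha₄S haS)) ha₆S
    set f : (w.integer)[X] := X ^ 2 + C c₁ * X - C c₀ with hf
    have hfmonic : f.Monic := by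
      rw [hf, sub_eq_add_neg, add_assoc]
      refine (monic_X_pow 2).add_of_left ?_
      refine (degree_add_le _ _).trans_lt (max_lt ?_ ?_)
      · exact (degree_C_mul_X_le _).trans_lt (by rw [degree_X_pow]; norm_num)
      · rw [degree_neg]; exact (degree_C_le).trans_lt (by rw [degree_X_pow]; norm_num)
    have hfcoeff : ∀ i, f.coeff i ∈ S := by
      intro i
      rw [hf]
      simp only [coeff_add, coeff_sub, coeff_X_pow, coeff_C_mul, coeff_X, coeff_C]
      refine S.sub_mem (S.add_mem ?_ (S.mul_mem hc₁S ?_)) ?_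
      · split_ifs
        · exact S.one_mem
        · exact S.zero_mem
      · split_ifs
        · exact S.one_mem
        · exact S.zero_mem
      · split_ifs
        · exact hc₀S
        · exact S.zero_mem
    have hroot : (f.map (IsLocalRing.residue w.integer)).IsRoot β₀ := by
      rw [IsRoot.def, eval_map, hf]
      simp only [eval₂_add, eval₂_sub, eval₂_mul, eval₂_pow, eval₂_C, eval₂_X, hc₁, hc₀, map_add,
        map_mul, map_pow, ha]
      linear_combination heq
    have hder : (f.map (IsLocalRing.residue w.integer)).derivative.eval β₀ ≠ 0 := by
      have : (f.map (IsLocalRing.residue w.integer)).derivative.eval β₀ =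
          2 * β₀ + IsLocalRing.residue w.integer W₀.a₁ * α₀ + IsLocalRing.residue w.integer W₀.a₃ := by
        rw [derivative_map, eval_map, hf]
        simp only [derivative_sub, derivative_X_pow, derivative_mul, derivative_C,
          derivative_X, zero_mul, zero_add, mul_one, sub_zero, eval₂_add, eval₂_mul, eval₂_ofNat,
          mul_zero, add_zero, eval₂_C, eval₂_X, hc₁, map_add, map_mul, ha, map_ofNat, Nat.cast_ofNat,
          pow_one, Nat.add_one_sub_one]
        ring
      rw [this]; exact hY
    obtain ⟨b, hb, hbβ, hbI⟩ := exists_isRoot_residue_eq_forall (v := v) f hfmonic β₀ hroot hder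
    have hbS : b ∈ S := fun τ hτ ↦ hbI _ (fun z ↦ spectralValuation_smul hw τ z)
      ((mem_inertia_iff_spectralValuation hw h𝔐).mp hτ) (fun i ↦ hfcoeff i τ hτ)
    have hWab : W₀.toAffine.Equation a b := by
      rw [Affine.equation_iff]
      rw [IsRoot.def, hf] at hb
      simp only [eval_add, eval_sub, eval_mul, eval_pow, eval_X, eval_C, hc₁, hc₀] at hb
      linear_combination hb
    exact ⟨a, b, hWab, ha, hbβ, haS, hbS⟩
  · -- lift `β₀` invariantly, solve the monic cubic in `X` by Hensel
    have hXp : IsLocalRing.residue w.integer W₀.a₁ * β₀ -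
        (3 * α₀ ^ 2 + 2 * IsLocalRing.residue w.integer W₀.a₂ * α₀ + IsLocalRing.residue w.integer W₀.a₄) ≠ 0 := by
      rw [not_not] at hY
      exact hpart.resolve_right (by rw [hY]; exact not_not.mpr rfl)
    obtain ⟨b, hb, hbI⟩ := exists_residue_eq_forall_inertia hw h𝔐 β₀
    have hbS : b ∈ S := hbI
    set c₂ : w.integer := W₀.a₂ with hc₂
    set c₁ : w.integer := W₀.a₄ - W₀.a₁ * b with hc₁
    set c₀ : w.integer := W₀.a₆ - b ^ 2 - W₀.a₃ * b with hc₀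
    have hc₂S : c₂ ∈ S := ha₂S
    have hc₁S : c₁ ∈ S := S.sub_mem ha₄S (S.mul_mem ha₁S hbS)
    have hc₀S : c₀ ∈ S := S.sub_mem (S.sub_mem ha₆S (S.pow_mem hbS 2)) (S.mul_mem ha₃S hbS)
    set g : (w.integer)[X] := X ^ 3 + C c₂ * X ^ 2 + C c₁ * X + C c₀ with hg
    have hgmonic : g.Monic := by
      rw [hg, add_assoc, add_assoc]
      refine (monic_X_pow 3).add_of_left ?_
      refine (degree_add_le _ _).trans_lt (max_lt ?_ ((degree_add_le _ _).trans_lt (max_lt ?_ ?_)))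
      · exact (degree_C_mul_X_pow_le 2 _).trans_lt (by rw [degree_X_pow]; norm_num)
      · exact (degree_C_mul_X_le _).trans_lt (by rw [degree_X_pow]; norm_num)
      · exact (degree_C_le).trans_lt (by rw [degree_X_pow]; norm_num)
    have hgcoeff : ∀ i, g.coeff i ∈ S := by
      intro i
      rw [hg]
      simp only [coeff_add, coeff_X_pow, coeff_C_mul, coeff_X, coeff_C]
      refine S.add_mem (S.add_mem (S.add_mem ?_ (S.mul_mem hc₂S ?_)) (S.mul_mem hc₁S ?_)) ?_
      · split_ifs
        · exact S.one_mem
        · exact S.zero_mem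
      · split_ifs
        · exact S.one_mem
        · exact S.zero_mem
      · split_ifs
        · exact S.one_mem
        · exact S.zero_mem
      · split_ifs
        · exact hc₀S
        · exact S.zero_mem
    have hroot : (g.map (IsLocalRing.residue w.integer)).IsRoot α₀ := by
      rw [IsRoot.def, eval_map, hg]
      simp only [eval₂_add, eval₂_sub, eval₂_mul, eval₂_pow, eval₂_C, eval₂_X, hc₂, hc₁, hc₀,
        map_sub, map_mul, map_pow, hb]
      linear_combination -heq
    have hder : (g.map (IsLocalRing.residue w.integer)).derivative.eval α₀ ≠ 0 := by
      have : (g.map (IsLocalRing.residue w.integer)).derivative.eval α₀ =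
          -(IsLocalRing.residue w.integer W₀.a₁ * β₀ -
            (3 * α₀ ^ 2 + 2 * IsLocalRing.residue w.integer W₀.a₂ * α₀ + IsLocalRing.residue w.integer W₀.a₄)) := by
        rw [derivative_map, eval_map, hg]
        simp only [derivative_add, derivative_X_pow, derivative_mul, derivative_C,
          derivative_X, zero_mul, zero_add, mul_one, add_zero, eval₂_add, eval₂_sub, eval₂_mul, eval₂_ofNat,
          mul_zero, sub_zero, eval₂_C, eval₂_X, eval₂_pow, hc₂, hc₁, map_sub, map_mul, hb, map_ofNat,
          Nat.cast_ofNat, pow_one, Nat.add_one_sub_one]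
        ring
      rw [this, neg_ne_zero]; exact hXp
    obtain ⟨a, ha, haα, haI⟩ := exists_isRoot_residue_eq_forall (v := v) g hgmonic α₀ hroot hder
    have haS : a ∈ S := fun τ hτ ↦ haI _ (fun z ↦ spectralValuation_smul hw τ z)
      ((mem_inertia_iff_spectralValuation hw h𝔐).mp hτ) (fun i ↦ hgcoeff i τ hτ)
    have hWab : W₀.toAffine.Equation a b := by
      rw [Affine.equation_iff]
      rw [IsRoot.def, hg] at ha
      simp only [eval_add, eval_mul, eval_pow, eval_X, eval_C, hc₂, hc₁, hc₀] at ha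
      linear_combination -ha
    exact ⟨a, b, hWab, haα, hb, haS, hbS⟩

end IsDedekindDomain.HeightOneSpectrum

/-! ## §3 `E₀(K_v^{nr})` is `n`-divisible at a bad place, `n` a unit of `𝓞_v` -/

namespace WeierstrassCurve

open Literature.NumberTheory.EllipticCurves Literature.NumberTheory.GaloisRepresentations
  Literature.NumberTheory.EllipticCurves.FormalGroupChart Field IsDedekindDomain.HeightOneSpectrum

variable {K : Type u} [Field K] [NumberField K] (W : WeierstrassCurve K) {v : HeightOneSpectrum (𝓞 K)}
  {w : Valuation (AlgebraicClosure (v.adicCompletion K)) ℝ≥0}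
  (hw : ∀ x, (w x : ℝ) = spectralNorm (v.adicCompletion K) (AlgebraicClosure (v.adicCompletion K)) x)

/-- At a place of bad reduction the minimal model `M = W.localMinimalIntegralModel v` has `Δ(M) ∈ 𝓂_v`
(Silverman, *AEC*, VII.5.1: good reduction iff `v(Δ_min) = 0`; Mathlib's trichotomy
`HasGoodReduction ∨ HasMultiplicativeReduction ∨ HasAdditiveReduction` for the minimal model). [folklore] -/
theorem Δ_localMinimalIntegralModel_mem_maximalIdeal (hbad : ¬ W.HasGoodReductionAt v) :
    (W.localMinimalIntegralModel v).Δ ∈ IsLocalRing.maximalIdeal (v.adicCompletionIntegers K) := by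
  have hlt : IsDedekindDomain.HeightOneSpectrum.valuation (v.adicCompletion K)
      (IsDiscreteValuationRing.maximalIdeal (v.adicCompletionIntegers K))
      (algebraMap (v.adicCompletionIntegers K) (v.adicCompletion K) (W.localMinimalIntegralModel v).Δ) < 1 := by
    rw [show W.localMinimalIntegralModel v = (W.localMinimalModel v).integralModel (v.adicCompletionIntegers K) from rfl,
      integralModel_Δ_eq]
    rcases hasGoodReductionAt_or_hasMultiplicativeReductionAt_or_hasAdditiveReductionAt v W with hg | hm | ha
    · exact absurd hg hbad
    · exact hm.badReduction
    · exact ha.badReduction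
  exact (IsDedekindDomain.HeightOneSpectrum.valuation_lt_one_iff_mem _ _).mp hlt

include hw in
set_option maxHeartbeats 1600000 in
/-- **`E₀(K_v^{nr})` is `n`-divisible at a place of bad reduction, for `n` prime to `v`.** Let `E/K` be an
elliptic curve over a number field, `v` a finite place of BAD reduction, `M = W.localMinimalIntegralModel v` the
minimal model, `V = (M ⊗ K_v) ⊗ K̄_v`, `|·|_v = w` the spectral valuation, `𝔐` the prime of `\bar 𝓞_v` above `𝓂_v`
with inertia group `I_𝔐 ≤ Γ_{K_v}` (so `V(K̄_v)^{I_𝔐} = E(K_v^{nr})`), and `n` a natural number which is a unit of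
`𝓞_v`. Then every `I_𝔐`-fixed point `P ∈ V(K̄_v)` with nonsingular reduction (`P ∈ E₀`,
`Literature.NumberTheory.EllipticCurves.ReducesToNonsingular`) is `n • Q` for an `I_𝔐`-fixed `Q ∈ E₀`. Proof
(Silverman, *AEC*, VII.2.1–2.2 and VII.3.1 over `K_v^{nr}`; Greenberg, LNM 1716, §2, `ℓ ≠ p`): on the
`𝒪_w`-model `W₀ = M ⊗ 𝒪_w` (`V = W₀ ⊗ K̄_v`) reduction is a homomorphism `E₀ → Ẽ_ns(k₀)` with kernel `E₁`
(`ReductionHomomorphism`); `Ẽ = W₀ mod 𝔪_w` is singular (`Δ(M) ∈ 𝓂_v`), `k₀ = 𝒪_w/𝔪_w` is algebraically closed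
(`isAlgClosed_residueField_integer`) and `n ≠ 0` in `k₀`, so `P̃ = n • R₁` in `Ẽ_ns(k₀)`
(`exists_nsmul_eq_of_Δ_eq_zero`); `R₁` lifts to an `I_𝔐`-FIXED `Y₁ ∈ E₀`
(`exists_equation_residue_eq_forall_inertia`); `D = P - n • Y₁ ∈ E₁` is `I_𝔐`-fixed, hence `D = n • Z` with
`Z ∈ E₁` (`exists_nsmul_eq_of_mem_kernel_of_forall_inertia`), and `Z` is `I_𝔐`-fixed because `Z^τ - Z ∈ E₁` is
killed by `n` (`eq_zero_of_nsmul_eq_zero_of_mem_kernel`, *AEC* VII.3.1); `Q = Y₁ + Z`.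
[cite: SilvermanAEC2009, Props. VII.2.1, VII.2.2, VII.3.1 and III.2.5] [cite: GreenbergLNM1716, §2 (Prop. 2.1, `ℓ ≠ p`)] -/
theorem exists_nsmul_eq_of_reducesToNonsingular_of_forall_inertia [W.IsElliptic]
    [hV : (((W.localMinimalIntegralModel v).map (algebraMap (v.adicCompletionIntegers K) (v.adicCompletion K))).baseChange (AlgebraicClosure (v.adicCompletion K))).IsIntegral w.integer]
    {𝔐 : Ideal v.localAbsIntegers} (h𝔐 : 𝔐 ∈ v.localPrimesAbove) (hbad : ¬ W.HasGoodReductionAt v)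
    {n : ℕ} (hn : IsUnit ((n : ℕ) : (v.adicCompletionIntegers K)))
    {P : (((W.localMinimalIntegralModel v).map (algebraMap (v.adicCompletionIntegers K) (v.adicCompletion K))).baseChange (AlgebraicClosure (v.adicCompletion K))).toAffine.Point}
    (hP₀ : ReducesToNonsingular w (IsLocalRing.residue w.integer) P)
    (hPI : ∀ τ ∈ 𝔐.inertia (absoluteGaloisGroup (v.adicCompletion K)), Affine.Point.map ((absoluteGaloisGroup.toAlgEquiv (v.adicCompletion K) τ : AlgebraicClosure (v.adicCompletion K) ≃ₐ[v.adicCompletion K] AlgebraicClosure (v.adicCompletion K)) : AlgebraicClosure (v.adicCompletion K) →ₐ[v.adicCompletion K] AlgebraicClosure (v.adicCompletion K)) P = P) :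
    ∃ Q : (((W.localMinimalIntegralModel v).map (algebraMap (v.adicCompletionIntegers K) (v.adicCompletion K))).baseChange (AlgebraicClosure (v.adicCompletion K))).toAffine.Point,
      ReducesToNonsingular w (IsLocalRing.residue w.integer) Q ∧
      (∀ τ ∈ 𝔐.inertia (absoluteGaloisGroup (v.adicCompletion K)), Affine.Point.map ((absoluteGaloisGroup.toAlgEquiv (v.adicCompletion K) τ : AlgebraicClosure (v.adicCompletion K) ≃ₐ[v.adicCompletion K] AlgebraicClosure (v.adicCompletion K)) : AlgebraicClosure (v.adicCompletion K) →ₐ[v.adicCompletion K] AlgebraicClosure (v.adicCompletion K)) Q = Q) ∧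
      n • Q = P := by
  haveI := W.isElliptic_map_localMinimalIntegralModel (v := v)
  haveI := W.isElliptic_baseChange_map_localMinimalIntegralModel (v := v)
  have hvw : w.Integers w.integer := Valuation.integer.integers w
  have hσw : ∀ (σ : absoluteGaloisGroup (v.adicCompletion K)) (z : AlgebraicClosure (v.adicCompletion K)), w (((absoluteGaloisGroup.toAlgEquiv (v.adicCompletion K) σ : AlgebraicClosure (v.adicCompletion K) ≃ₐ[v.adicCompletion K] AlgebraicClosure (v.adicCompletion K)) : AlgebraicClosure (v.adicCompletion K) →ₐ[v.adicCompletion K] AlgebraicClosure (v.adicCompletion K)) z) = w z :=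
    fun σ z ↦ spectralValuation_smul hw σ z
  -- the model `W₀ = M ⊗ 𝒪_w` and the identification `V = W₀ ⊗ K̄_v`
  obtain ⟨ι, hι⟩ := exists_ringHom_adicCompletionIntegers_integer (v := v) hw
  haveI hιloc := isLocalHom_of_coe_eq hw hι
  set W₀ : WeierstrassCurve w.integer := (W.localMinimalIntegralModel v).map ι with hW₀
  have hcompL : (algebraMap w.integer (AlgebraicClosure (v.adicCompletion K))).comp ι =
      (algebraMap (v.adicCompletion K) (AlgebraicClosure (v.adicCompletion K))).comp (algebraMap (v.adicCompletionIntegers K) (v.adicCompletion K)) := by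
    ext a
    exact hι a
  have hX : ((W.localMinimalIntegralModel v).map (algebraMap (v.adicCompletionIntegers K) (v.adicCompletion K))).baseChange (AlgebraicClosure (v.adicCompletion K)) = W₀.baseChange (AlgebraicClosure (v.adicCompletion K)) := by
    simp only [baseChange, hW₀, map_map, hcompL]
  haveI : (W₀.baseChange (AlgebraicClosure (v.adicCompletion K))).IsIntegral w.integer := ⟨⟨W₀, rfl⟩⟩
  -- the coefficients of `W₀` come from `K_v`, hence are fixed by `I_𝔐`
  have hιfix : ∀ (c : v.adicCompletionIntegers K), ∀ τ ∈ 𝔐.inertia (absoluteGaloisGroup (v.adicCompletion K)),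
      absoluteGaloisGroup.toAlgEquiv (v.adicCompletion K) τ ((ι c : w.integer) : AlgebraicClosure (v.adicCompletion K)) = ι c :=
    fun c τ _ ↦ by rw [hι]; exact AlgEquiv.commutes _ _
  have hW₀fix : ∀ τ ∈ 𝔐.inertia (absoluteGaloisGroup (v.adicCompletion K)),
      absoluteGaloisGroup.toAlgEquiv (v.adicCompletion K) τ (W₀.a₁ : AlgebraicClosure (v.adicCompletion K)) = W₀.a₁ ∧
      absoluteGaloisGroup.toAlgEquiv (v.adicCompletion K) τ (W₀.a₂ : AlgebraicClosure (v.adicCompletion K)) = W₀.a₂ ∧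
      absoluteGaloisGroup.toAlgEquiv (v.adicCompletion K) τ (W₀.a₃ : AlgebraicClosure (v.adicCompletion K)) = W₀.a₃ ∧
      absoluteGaloisGroup.toAlgEquiv (v.adicCompletion K) τ (W₀.a₄ : AlgebraicClosure (v.adicCompletion K)) = W₀.a₄ ∧
      absoluteGaloisGroup.toAlgEquiv (v.adicCompletion K) τ (W₀.a₆ : AlgebraicClosure (v.adicCompletion K)) = W₀.a₆ := by
    intro τ hτ
    refine ⟨?_, ?_, ?_, ?_, ?_⟩
    · rw [hW₀, map_a₁]; exact hιfix _ τ hτ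
    · rw [hW₀, map_a₂]; exact hιfix _ τ hτ
    · rw [hW₀, map_a₃]; exact hιfix _ τ hτ
    · rw [hW₀, map_a₄]; exact hιfix _ τ hτ
    · rw [hW₀, map_a₆]; exact hιfix _ τ hτ
  -- the reduced cubic `Ẽ = W₀ mod 𝔪_w` is singular, `k₀` is algebraically closed, `n ≠ 0` in `k₀`
  have hΔ : (W₀.map (IsLocalRing.residue w.integer)).Δ = 0 := by
    rw [map_Δ, IsLocalRing.residue_eq_zero_iff, hW₀, map_Δ, IsLocalRing.mem_maximalIdeal]
    exact (map_mem_nonunits_iff ι _).mpr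
      ((IsLocalRing.mem_maximalIdeal _).mp (W.Δ_localMinimalIntegralModel_mem_maximalIdeal hbad))
  have hnk : ((n : ℕ) : IsLocalRing.ResidueField w.integer) ≠ 0 := by
    have h1 : IsUnit ((n : ℕ) : w.integer) := by
      have := hn.map ι
      rwa [map_natCast] at this
    rw [← map_natCast (IsLocalRing.residue w.integer), ne_eq, IsLocalRing.residue_eq_zero_iff,
      IsLocalRing.mem_maximalIdeal]
    exact fun h ↦ h h1
  haveI : IsAlgClosed (IsLocalRing.ResidueField w.integer) := isAlgClosed_residueField_integer w
  -- `E₀` along the identification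
  have hE₀iff : ∀ Q : (((W.localMinimalIntegralModel v).map (algebraMap (v.adicCompletionIntegers K) (v.adicCompletion K))).baseChange (AlgebraicClosure (v.adicCompletion K))).toAffine.Point,
      ReducesToNonsingular w (IsLocalRing.residue w.integer) Q ↔ W₀.HasNonsingularReduction (Affine.Point.congrEquiv hX Q) := by
    intro Q
    rw [← reducesToNonsingular_iff_hasNonsingularReduction W₀, WeierstrassCurve.reducesToNonsingular_congrEquiv_iff w _ hX Q]
  have hP' : W₀.HasNonsingularReduction (Affine.Point.congrEquiv hX P) := (hE₀iff P).mp hP₀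
  -- integral points of `W₀` give points of `V`
  have hWeq : ∀ a b : w.integer, W₀.toAffine.Equation a b →
      (((W.localMinimalIntegralModel v).map (algebraMap (v.adicCompletionIntegers K) (v.adicCompletion K))).baseChange
        (AlgebraicClosure (v.adicCompletion K))).toAffine.Nonsingular
        (a : AlgebraicClosure (v.adicCompletion K)) (b : AlgebraicClosure (v.adicCompletion K)) := by
    intro a b hab
    rw [← Affine.equation_iff_nonsingular, hX]
    exact (map_equation_iff hvw.hom_inj).mpr hab
  -- Step 1: divide the reduction `P̃ ∈ Ẽ_ns(k₀)` by `n`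
  obtain ⟨R₁, hR₁⟩ := (W₀.map (IsLocalRing.residue w.integer)).exists_nsmul_eq_of_Δ_eq_zero hΔ hnk
    (W₀.reducePoint (Affine.Point.congrEquiv hX P))
  -- Step 2: an `I_𝔐`-fixed lift `Y₁ ∈ E₀` of `R₁`
  obtain ⟨Y₁, hY₁E₀, hY₁I, hY₁red⟩ : ∃ Y₁ : (((W.localMinimalIntegralModel v).map (algebraMap (v.adicCompletionIntegers K) (v.adicCompletion K))).baseChange (AlgebraicClosure (v.adicCompletion K))).toAffine.Point,
      ReducesToNonsingular w (IsLocalRing.residue w.integer) Y₁ ∧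
      (∀ τ ∈ 𝔐.inertia (absoluteGaloisGroup (v.adicCompletion K)), Affine.Point.map ((absoluteGaloisGroup.toAlgEquiv (v.adicCompletion K) τ : AlgebraicClosure (v.adicCompletion K) ≃ₐ[v.adicCompletion K] AlgebraicClosure (v.adicCompletion K)) : AlgebraicClosure (v.adicCompletion K) →ₐ[v.adicCompletion K] AlgebraicClosure (v.adicCompletion K)) Y₁ = Y₁) ∧
      W₀.reducePoint (Affine.Point.congrEquiv hX Y₁) = R₁ := by
    rcases R₁ with _ | ⟨α₀, β₀, hns⟩
    · exact ⟨0, reducesToNonsingular_zero, fun τ _ ↦ map_zero _, by rw [map_zero, reducePoint_zero, ← Affine.Point.zero_def]⟩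
    · obtain ⟨a, b, hab, ha, hb, habI⟩ := exists_equation_residue_eq_forall_inertia hw h𝔐 W₀ hW₀fix hns
      have hL := hWeq a b hab
      have hh : (W₀.baseChange (AlgebraicClosure (v.adicCompletion K))).toAffine.Nonsingular
          (algebraMap w.integer (AlgebraicClosure (v.adicCompletion K)) a)
          (algebraMap w.integer (AlgebraicClosure (v.adicCompletion K)) b) := by
        have := hL
        rw [hX] at this
        exact this
      have hns' : (W₀.map (IsLocalRing.residue w.integer)).toAffine.Nonsingular (IsLocalRing.residue w.integer a)
          (IsLocalRing.residue w.integer b) := by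
        rw [ha, hb]; exact hns
      refine ⟨.some _ _ hL, ?_, fun τ hτ ↦ ?_, ?_⟩
      · rw [hE₀iff, Affine.Point.congrEquiv_some]
        change W₀.HasNonsingularReduction (.some _ _ hh)
        exact (hasNonsingularReduction_some_algebraMap_iff hvw.hom_inj hh).mpr hns'
      · rw [Affine.Point.map_some]
        exact point_some_eq_some (habI τ hτ).1 (habI τ hτ).2
      · rw [Affine.Point.congrEquiv_some]
        change W₀.reducePoint (.some _ _ hh) = _
        rw [reducePoint_some_algebraMap hvw.hom_inj hh hns']
        exact point_some_eq_some ha hb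
  have hY₁' : W₀.HasNonsingularReduction (Affine.Point.congrEquiv hX Y₁) := (hE₀iff Y₁).mp hY₁E₀
  -- Step 3: `D = P - n • Y₁ ∈ E₀` is `I_𝔐`-fixed and reduces to `Õ`, hence lies in `E₁`
  have hDE₀' : W₀.HasNonsingularReduction (Affine.Point.congrEquiv hX (P - n • Y₁)) := by
    rw [map_sub, map_nsmul, sub_eq_add_neg]
    exact hP'.add hvw ((W₀.nonsingularReductionSubgroup hvw).nsmul_mem hY₁' n).neg
  have hDI : ∀ τ ∈ 𝔐.inertia (absoluteGaloisGroup (v.adicCompletion K)), Affine.Point.map ((absoluteGaloisGroup.toAlgEquiv (v.adicCompletion K) τ : AlgebraicClosure (v.adicCompletion K) ≃ₐ[v.adicCompletion K] AlgebraicClosure (v.adicCompletion K)) : AlgebraicClosure (v.adicCompletion K) →ₐ[v.adicCompletion K] AlgebraicClosure (v.adicCompletion K)) (P - n • Y₁) = P - n • Y₁ :=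
    fun τ hτ ↦ by rw [map_sub, map_nsmul, hPI τ hτ, hY₁I τ hτ]
  have hDred : W₀.reducePoint (Affine.Point.congrEquiv hX (P - n • Y₁)) = 0 := by
    have h := map_sub (reductionHom W₀ hvw) ⟨_, hP'⟩ (n • ⟨_, hY₁'⟩)
    rw [map_nsmul, reductionHom_apply, reductionHom_apply, reductionHom_apply] at h
    simp only [AddSubgroupClass.coe_sub, AddSubgroupClass.coe_nsmul] at h
    rw [map_sub, map_nsmul, h, hY₁red, hR₁, sub_self]
  have hDker : P - n • Y₁ ∈ kernel w (((W.localMinimalIntegralModel v).map (algebraMap (v.adicCompletionIntegers K) (v.adicCompletion K))).baseChange (AlgebraicClosure (v.adicCompletion K))) := by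
    have hz : W₀.ReducesToZero (Affine.Point.congrEquiv hX (P - n • Y₁)) :=
      (reducePoint_eq_zero_iff hvw hDE₀').mp hDred
    generalize hD : P - n • Y₁ = D
    rw [hD] at hz
    rcases D with _ | ⟨x, y, hxy⟩
    · rw [← Affine.Point.zero_def]
      exact AddSubgroup.zero_mem _
    · rw [Affine.Point.congrEquiv_some, WeierstrassCurve.reducesToZero_some_iff, not_mem_range_iff hvw] at hz
      intro x' y' h' he
      simp only [Affine.Point.some.injEq] at he
      rw [← he.1]
      exact hz
  -- Step 4: divide `D` inside `E₁` by `n`; the quotient is `I_𝔐`-fixed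
  obtain ⟨Z, hZK, hZ⟩ := W.exists_nsmul_eq_of_mem_kernel_of_forall_inertia hw h𝔐 hn hDker hDI
  have hZI : ∀ τ ∈ 𝔐.inertia (absoluteGaloisGroup (v.adicCompletion K)), Affine.Point.map ((absoluteGaloisGroup.toAlgEquiv (v.adicCompletion K) τ : AlgebraicClosure (v.adicCompletion K) ≃ₐ[v.adicCompletion K] AlgebraicClosure (v.adicCompletion K)) : AlgebraicClosure (v.adicCompletion K) →ₐ[v.adicCompletion K] AlgebraicClosure (v.adicCompletion K)) Z = Z := by
    intro τ hτ
    have hmem : Affine.Point.map ((absoluteGaloisGroup.toAlgEquiv (v.adicCompletion K) τ : AlgebraicClosure (v.adicCompletion K) ≃ₐ[v.adicCompletion K] AlgebraicClosure (v.adicCompletion K)) : AlgebraicClosure (v.adicCompletion K) →ₐ[v.adicCompletion K] AlgebraicClosure (v.adicCompletion K)) Z - Z ∈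
        kernel w (((W.localMinimalIntegralModel v).map (algebraMap (v.adicCompletionIntegers K) (v.adicCompletion K))).baseChange (AlgebraicClosure (v.adicCompletion K))) :=
      (kernel w _).sub_mem ((map_mem_kernel_iff (hσw τ) Z).mpr hZK) hZK
    have h0 : n • (Affine.Point.map ((absoluteGaloisGroup.toAlgEquiv (v.adicCompletion K) τ : AlgebraicClosure (v.adicCompletion K) ≃ₐ[v.adicCompletion K] AlgebraicClosure (v.adicCompletion K)) : AlgebraicClosure (v.adicCompletion K) →ₐ[v.adicCompletion K] AlgebraicClosure (v.adicCompletion K)) Z - Z) = 0 := by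
      rw [smul_sub, ← map_nsmul, hZ, hDI τ hτ, sub_self]
    exact sub_eq_zero.mp (W.eq_zero_of_nsmul_eq_zero_of_mem_kernel hw hn hmem h0)
  have hZE₀ : ReducesToNonsingular w (IsLocalRing.residue w.integer) Z := by
    rcases hZc : Z with _ | ⟨x, y, hxy⟩
    · exact reducesToNonsingular_zero
    · rw [hZc] at hZK
      exact reducesToNonsingular_of_one_lt ((some_mem_kernel_iff hxy).mp hZK)
  -- conclusion: `Q = Y₁ + Z`
  refine ⟨Y₁ + Z, ?_, fun τ hτ ↦ by rw [map_add, hY₁I τ hτ, hZI τ hτ], by rw [nsmul_add, hZ, add_sub_cancel]⟩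
  rw [hE₀iff, map_add]
  exact hY₁'.add hvw ((hE₀iff Z).mp hZE₀)

end WeierstrassCurve

end
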